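import Literature.NumberTheory.EllipticCurves.CastellaGrossiSkinner2025.MazurMainConjecture
import HarnessLib

/-!
# Keller–Yin (arXiv:2402.12781v2) Thm. 3.0.10: Mazur's cyclotomic (MC) at EVERY good Eisenstein prime
# `p > 2` — an explicitly labelled PREPRINT CLAIM (`_OPEN`, `[claim: …, status: under-review]`), typed in
# the exact currency of the tree's PUBLISHED twins `GreenbergVatsal2000.thm13_charIdeal_eq_of_gvPar`
# (GV 2000 Thm. 1.3: parity (GV)) and `CastellaGrossiSkinner2025.thmA_charIdeal_eq_padicLFunction`
# (CGS 2025 Thm. A: `φ|_{G_p} ≠ 1, ω`)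

HONEST FRAMING (cell `bsd-eis`, home `run/shared/lean/pub/bsd-eis/`; FULL-BSD rank ≤ 1 programme;
seat `bsd-eis-k5-ty`, D-0074 group (C) row E (ii) "KY v2 … Thm 3.0.10 typed as named PRE statement
with v2 locators"). T. Keller, M. Yin, *On the anticyclotomic Iwasawa theory of newforms at
Eisenstein primes of semistable reduction*, arXiv:2402.12781v2 (30 Oct 2024) is an UNREFEREED
PREPRINT. Nothing in this file is a theorem of the tree: the one `def … : Prop` below transcribes
the preprint's Theorem 3.0.10 (NEW in v2, absent from v1; unlabeled in the TeX; PDF p. 41, TeX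
L1651–L1655) for an elliptic curve over `ℚ`, and is to be taken as an explicit HYPOTHESIS BY NAME,
exactly like the sibling `thm308_imc2_bdpValue_goodLattice_OPEN` (`AnomalousAnticyclotomicMainConjecture.lean`).
It carries the suffix `_OPEN` and the tag `[claim: KellerYin2024, status: under-review]`.

WHY IT IS TYPED. It is the PRE half of the K5 route's crux 5 `MazurMCOnX1RankZero`
(`Summit.BirchSwinnertonDyer.BirchSwinnertonDyer.Theses.EisensteinPrimes`, item
stmt-BirchSwinnertonDyer-19035: `∀ W p, ClassX1 W p → r_an = 0 → Rank1ResidualX1Defs.MazurMainConjecture W p`;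
`ClassX1 ⊆ {2 < p ∧ Red ∧ Good ∧ Anom}`), whose skeleton per the D-0074 brief is "Kato half [PUB] +
KY 3.0.10 half [PRE, ONE NAMED STUB] + per-pair certificate road": the conclusion below is, binder
for binder, `Rank1ResidualX1Defs.MazurMainConjecture W p` (Summits side; identical text), so the
PRE closer of crux 5 is a one-line specialisation on the Summits side (k5-c5's file, not this one).
Referee NIT-g15-4 (HOME/REF-VERDICT-WAVE-g15.md §7): crux 5's prose "no published argument gives
the reverse divisibility … open since GV 2000" is right for REFEREED print but should NAME this PRE
claim — this file gives it a name.

STATUS OF THE CLAIM — THE CELL'S AUDIT SAYS THE PRINTED PROOF HAS A LOCATED GAP (numbers, not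
adjectives). KY's proof is two sentences (TeX L1656–L1658, verbatim in the citation header): "This is
the main result of [CGS]. Their technical assumption on the local behaviors of the characters in the
semisimplification of `E[p]` can be removed if one replaces the appeal to [CGLS, Theorem 4.2.2,
Corollary 4.2.3] by our Theorem 3.0.8 and Remark 3.0.9 (specialized to weight 2 case)." The cell's
line-by-line verification `HOME/bsd-eis-ky-MEMO-1.md` §5.1 (seat bsd-eis-ky; cross-family referee
PASS, `HOME/REF-VERDICT-ky-MEMO-1.md`) finds that CGS's cyclotomic argument uses the non-anomalous
hypothesis OUTSIDE the anticyclotomic input at four located places (C1 CGS Lemma `almost-div-ord`;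
C2 Lemma `coinv` / Prop. `euler-char`; C3 Thms. 5.5.1/5.5.2 "Assume `E(K)[p] = 0`"; C4/C4′ the
curve is FIXED to Wüthrich's `X₁(N)`-optimal member `E_•`, which on a type-A class with a rational
`p`-torsion point — 1 438 of the 1 487 census classes — has `E_•(ℚ)[p] ≠ 0`, so the lattice cannot
be switched as in the anticyclotomic argument), and concludes: "KY v1 §0.5 / v2 Thm 3.0.10 … is not
a proof; Mazur's main conjecture at a type-A anomalous prime is NOT established by KY + CGS as
printed. GAP(KY §0.5; KY Thm 4.2.1 proof, r = 0 sentence) with locators C1–C4." NEVER cite this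
`Prop` as a theorem. On the complementary loci the SAME conclusion is PUBLISHED and already typed:
`¬ Anom W p` ⇒ CGS 2025 Thm. A (`CastellaGrossiSkinner2025.thmA_charIdeal_eq_padicLFunction`);
`GVPar W p` ⇒ GV 2000 Thm. 1.3 (`GreenbergVatsal2000.thm13_charIdeal_eq_of_gvPar`); so the content
of the claim beyond print is exactly the locus `Anom W p ∧ ¬ GVPar W p` (class X1 "type A"), which
is the tree's `@[conjecture]` `Rank1ResidualX1Defs.MazurMainConjectureOnX1TypeA` — the theorem
`thm3010_OPEN_iff_thmA_and_anom` below PROVES this bookkeeping in the kernel (no new fact).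
Print placement of the underlying conjecture: Mazur 1972 p. 189; Mazur–Swinnerton-Dyer 1974 §9.5
Conj. 3; Greenberg LNM 1716 Conj. 1.13 (LIT-DOSSIER §28 row 5).

## Citation header

* T. Keller, M. Yin, arXiv:2402.12781v2 (2024-10-30; TeX source of record
  `HOME/lit/src/ky24-v2/main.tex`, numbering concordance `HOME/lit/INDEX.md` §1, PDF page map
  `HOME/lit/src/ky24-v2/PAGEMAP-v2.md`): **Theorem 3.0.10** (unlabeled; §3, after Rem. 3.0.9
  `allowtor`; PDF p. 41; TeX L1649–L1658), verbatim: "As a corollary of our anticyclotomic Main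
  Conjectures, we also obtain the following Mazur's Main Conjecture for elliptic curves
  unconditionally in the Eisenstein case using the main results of [CGS]. Let
  `Λ_ℚ := ℤ_p⟦Gal(ℚ^∞/ℚ)⟧` be the cyclotomic Iwasawa algebra over `ℚ`. Let `𝔛_ord(E/ℚ_∞)` be the
  Pontryagin dual of the `p`-primary Selmer group `Sel_{p^∞}(E/ℚ_∞)` for `E` and let
  `𝓛_p^{MSD}(E/ℚ)` be the Mazur–Swinnerton-Dyer `p`-adic `L`-function. THEOREM. Let `E/ℚ` be an
  elliptic curve, and let `p > 2` be a prime of good reduction for `E`. Suppose that `p` is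
  Eisenstein. Then `𝔛_ord(E/ℚ_∞)` is `Λ_ℚ`-cotorsion with
  `Char_{Λ_ℚ}(𝔛_ord(E/ℚ_∞)) = 𝓛_p^{MSD}(E/ℚ)`, and hence Mazur's Main Conjecture holds. PROOF. This is
  the main result of [CGS]. Their technical assumption on the local behaviors of the characters in
  the semisimplification of `E[p]` can be removed if one replaces the appeal to [CGLS, Theorem 4.2.2,
  Corollary 4.2.3] by our Theorem 3.0.8 and Remark 3.0.9 (specialized to weight 2 case)." ("`p` is
  Eisenstein" = `E[p]` reducible, §0; [CGS] = Castella–Grossi–Skinner, cited as the 2023 preprint,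
  now Math. Ann. 393 (2025).) In v1 (store text `paper:arxiv-2402.12781`) the statement is only the
  prose sentence of §0.5 "Relation to previous works". UNREFEREED PREPRINT. Bib key `KellerYin2024`.
* The TRANSCRIPTION is word for word that of the tree's CGS Thm. A fact (module docstring of
  `CastellaGrossiSkinner2025/MazurMainConjecture.lean`, items 1–6, themselves verbatim from the GV
  Thm. 1.3 fact), with item 3 ("`φ|_{G_p} ≠ 1, ω`" = `¬ Anom W p`) DELETED and nothing else changed:
  `W` globally minimal elliptic over `ℚ`; `2 < p`, `Good W p`, `Red W p` ("`p > 2` … good reduction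
  … Eisenstein"); `κ : ZpExtension ℚ p` cyclotomic with topological generator `γ` matching the
  cyclotomic variable (`IsCyclotomicVariable p γ`); the newform `f` of `E` at level `N_E`
  (`IsNewformOf W f`); the rational `ϖ` with `ϖ · Ω_E = Ω⁺_f` renormalising the tree's
  Mazur–Tate–Teitelbaum `padicLFunction f α` (`α = unitRoot W p`; good ORDINARY is automatic,
  `goodOrd_of_red_of_good`) to the model's real period = `𝓛_p^{MSD}(E/ℚ)` up to the unit `c_∞`; every
  dual datum `D : W.SelmerDualData κ γ` (`𝔛_ord(E/ℚ_∞)`); conclusion `D.IsTorsion ∧ ∃ g, D.charIdeal =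
  (g) ∧ ι g = ϖ · L_p(f, α)`. This is also, binder for binder, the Summits-side
  `Rank1ResidualX1Defs.MazurMainConjecture W p`.

## Contents

* `thm3010_charIdeal_eq_padicLFunction_OPEN` — the ONE new named statement (PRE claim).
* PROVED bookkeeping (no fact minted): `thm3010_OPEN.thmA` (the claim contains CGS Thm. A),
  `thm3010_OPEN.of_gvPar_or_not_anom_or_anom` (pointwise: the claim at `(W, p)` is GV 1.3 ∨ CGS A on
  their loci), `thm3010_OPEN_iff_thmA_and_anom` (the claim ⟺ CGS Thm. A ∧ its own restriction to
  `Anom W p` — i.e. its content beyond CGS is exactly the anomalous locus).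

## References
* [KellerYin2024] arXiv:2402.12781v2, Thm. 3.0.10 (p. 41, TeX L1649–1658); Thm. 3.0.8, Rem. 3.0.9;
  §0.6 (L346–350); v1 §0.5.
* [CastellaGrossiSkinner2025] Math. Ann. 393 (2025), Theorem A = Thm. 6.0.5 — tree fact
  `thmA_charIdeal_eq_padicLFunction` (binder list reused verbatim).
* [GreenbergVatsal2000] Invent. Math. 142 (2000), Thm. (1.3) — tree fact `thm13_charIdeal_eq_of_gvPar`.
* HOME/bsd-eis-ky-MEMO-1.md §5.1 (GAP locators C1–C4′), HOME/REF-VERDICT-ky-MEMO-1.md (PASS),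
  HOME/LIT-DOSSIER.md §28 row 5 (print placement), HOME/REF-VERDICT-WAVE-g15.md NIT-g15-4.
-/

set_option autoImplicit false

noncomputable section

open scoped Classical MatrixGroups ModularForm

open CongruenceSubgroup WeierstrassCurve Literature.NumberTheory.EllipticCurves
  Literature.NumberTheory.EllipticCurves.ModularForms Literature.NumberTheory.EllipticCurves.Rank1Residual

namespace Literature.NumberTheory.EllipticCurves.KellerYin2024

/-- **Keller–Yin, arXiv:2402.12781v2, Theorem 3.0.10 (PDF p. 41; TeX L1651–L1655; NEW in v2) —
UNREFEREED PREPRINT CLAIM, typed as a hypothesis by name (`_OPEN`).** "Let `E/ℚ` be an elliptic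
curve, and let `p > 2` be a prime of good reduction for `E`. Suppose that `p` is Eisenstein [`E[p]`
reducible]. Then `𝔛_ord(E/ℚ_∞)` is `Λ_ℚ`-cotorsion with `Char_{Λ_ℚ}(𝔛_ord(E/ℚ_∞)) = 𝓛_p^{MSD}(E/ℚ)`,
and hence Mazur's Main [statement (MC)] holds." Transcription = the tree's CGS 2025 Thm. A fact
`CastellaGrossiSkinner2025.thmA_charIdeal_eq_padicLFunction` with the hypothesis `¬ Anom W p`
("`φ|_{G_p} ≠ 1, ω`") DELETED and nothing else changed (module docstring): `2 < p`, `Good W p`,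
`Red W p`; cyclotomic `κ`, `γ` matching the cyclotomic variable; the newform `f` of `E`; `ϖ` with
`ϖ · Ω_E = Ω⁺_f`; every dual datum `D` (`𝔛_ord(E/ℚ_∞)`) is `Λ`-torsion with `char_Λ D = (g)`,
`ι g = ϖ · L_p(f, α)`, `α = unitRoot W p`. KY's printed proof (L1656–L1658): "This is the main result
of [CGS]. Their technical assumption … can be removed if one replaces the appeal to [CGLS, Theorem
4.2.2, Corollary 4.2.3] by our Theorem 3.0.8 and Remark 3.0.9". CELL AUDIT (HOME/bsd-eis-ky-MEMO-1.md
§5.1, referee PASS): NOT a proof at type-A anomalous pairs — GAP with locators C1–C4′ (CGS's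
cyclotomic machinery uses `E_•(K)[p] = 0` for Wüthrich's FIXED curve `E_•` outside the anticyclotomic
input). On `¬ Anom` the statement is CGS Thm. A [PUB], on `GVPar` it is GV Thm. 1.3 [PUB]
(`thm3010_OPEN_iff_thmA_and_anom`). NEVER cite this `Prop` as a theorem; it is the named PRE stub of
the K5 route's crux 5 `MazurMCOnX1RankZero`. [claim: KellerYin2024, status: under-review]
[cite: KellerYin2024, Thm. 3.0.10 (arXiv:2402.12781v2 p. 41, TeX L1649–1658; absent from v1, cf. v1 §0.5)]
[cite: CastellaGrossiSkinner2025, Theorem A = Thm. 6.0.5 (binder list of the tree transcription reused verbatim)] -/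
def thm3010_charIdeal_eq_padicLFunction_OPEN : Prop :=
  ∀ (W : WeierstrassCurve ℚ) [W.IsElliptic] [W.IsGloballyMinimal] (p : ℕ) [Fact p.Prime],
    2 < p → Good W p → Red W p →
    ∀ (κ : ZpExtension ℚ p) (γ : Field.absoluteGaloisGroup ℚ),
        κ.IsCyclotomic → κ.IsTopGenerator γ → IsCyclotomicVariable p γ →
      ∀ [NeZero (W.conductorNorm ℤ)] (f : CuspForm (Gamma0 (W.conductorNorm ℤ)) 2),
        IsNewformOf W f → ∀ (ϖ : ℚ), (ϖ : ℝ) * W.realPeriodRat = plusPeriod f →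
      ∀ (D : W.SelmerDualData κ γ), D.IsTorsion ∧
        ∃ g : IwasawaAlgebra p, D.charIdeal = Ideal.span {g} ∧
          iwasawaToPowerSeries p g =
            PowerSeries.C (ϖ : ℚ_[p]) * padicLFunction f (unitRoot W p : ℚ_[p])

/-- The claim CONTAINS Castella–Grossi–Skinner 2025 Thm. A (drop the hypothesis `¬ Anom W p`):
what is new in Thm. 3.0.10 relative to [CGS] is only the anomalous locus.
[cite: KellerYin2024, Thm. 3.0.10 and its proof (arXiv:2402.12781v2 TeX L1656–1658: "This is the main result of [CGS] …")]
[cite: CastellaGrossiSkinner2025, Theorem A] -/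
theorem thm3010_OPEN.thmA (h : thm3010_charIdeal_eq_padicLFunction_OPEN) :
    CastellaGrossiSkinner2025.thmA_charIdeal_eq_padicLFunction :=
  fun W _ _ p _ hp hgood hred _ κ γ hκ hγ hT _ f hf ϖ hϖ D ↦
    h W p hp hgood hred κ γ hκ hγ hT f hf ϖ hϖ D

/-- **The content of the claim beyond print is exactly the anomalous locus**: Thm. 3.0.10 ⟺
(CGS 2025 Thm. A) ∧ (Thm. 3.0.10 restricted to `Anom W p`, i.e. `a_p ≡ 1 (mod p)` — stated inline,
no new name). Pure logic (`Anom W p ∨ ¬ Anom W p`). [cite: KellerYin2024, Thm. 3.0.10 (arXiv:2402.12781v2 p. 41)]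
[cite: CastellaGrossiSkinner2025, Theorem A (hypothesis "φ|_{G_p} ≠ 1, ω")] -/
theorem thm3010_OPEN_iff_thmA_and_anom :
    thm3010_charIdeal_eq_padicLFunction_OPEN ↔
      CastellaGrossiSkinner2025.thmA_charIdeal_eq_padicLFunction ∧
      ∀ (W : WeierstrassCurve ℚ) [W.IsElliptic] [W.IsGloballyMinimal] (p : ℕ) [Fact p.Prime],
        2 < p → Good W p → Red W p → Anom W p →
        ∀ (κ : ZpExtension ℚ p) (γ : Field.absoluteGaloisGroup ℚ),
            κ.IsCyclotomic → κ.IsTopGenerator γ → IsCyclotomicVariable p γ →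
          ∀ [NeZero (W.conductorNorm ℤ)] (f : CuspForm (Gamma0 (W.conductorNorm ℤ)) 2),
            IsNewformOf W f → ∀ (ϖ : ℚ), (ϖ : ℝ) * W.realPeriodRat = plusPeriod f →
          ∀ (D : W.SelmerDualData κ γ), D.IsTorsion ∧
            ∃ g : IwasawaAlgebra p, D.charIdeal = Ideal.span {g} ∧
              iwasawaToPowerSeries p g =
                PowerSeries.C (ϖ : ℚ_[p]) * padicLFunction f (unitRoot W p : ℚ_[p]) := by
  constructor
  · intro h
    exact ⟨thm3010_OPEN.thmA h, fun W _ _ p _ hp hgood hred _ κ γ hκ hγ hT _ f hf ϖ hϖ D ↦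
      h W p hp hgood hred κ γ hκ hγ hT f hf ϖ hϖ D⟩
  · rintro ⟨hA, hAnom⟩ W _ _ p _ hp hgood hred κ γ hκ hγ hT _ f hf ϖ hϖ D
    by_cases ha : Anom W p
    · exact hAnom W p hp hgood hred ha κ γ hκ hγ hT f hf ϖ hϖ D
    · exact hA W p hp hgood hred ha κ γ hκ hγ hT f hf ϖ hϖ D

/-- Pointwise form for consumers: granted the claim, the (MC) conclusion at a good Eisenstein
`p > 2` — and on the loci `GVPar W p` resp. `¬ Anom W p` the PUBLISHED facts GV Thm. 1.3 resp.
CGS Thm. A give it WITHOUT the claim (`CastellaGrossiSkinner2025.charIdeal_eq_of_gvPar_or_not_anom`),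
so a consumer should case on `GVPar W p ∨ ¬ Anom W p` first and use this only on `Anom ∧ ¬ GVPar`
(class X1 type A). [cite: KellerYin2024, Thm. 3.0.10 (arXiv:2402.12781v2 p. 41)]
[cite: GreenbergVatsal2000, Thm. (1.3)] [cite: CastellaGrossiSkinner2025, Theorem A] -/
theorem thm3010_OPEN.charIdeal_eq (h : thm3010_charIdeal_eq_padicLFunction_OPEN)
    (W : WeierstrassCurve ℚ) [W.IsElliptic] [W.IsGloballyMinimal] (p : ℕ) [Fact p.Prime]
    (hp : 2 < p) (hgood : Good W p) (hred : Red W p)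
    (κ : ZpExtension ℚ p) (γ : Field.absoluteGaloisGroup ℚ)
    (hκ : κ.IsCyclotomic) (hγ : κ.IsTopGenerator γ) (hT : IsCyclotomicVariable p γ)
    [NeZero (W.conductorNorm ℤ)] (f : CuspForm (Gamma0 (W.conductorNorm ℤ)) 2)
    (hf : IsNewformOf W f) (ϖ : ℚ) (hϖ : (ϖ : ℝ) * W.realPeriodRat = plusPeriod f)
    (D : W.SelmerDualData κ γ) :
    D.IsTorsion ∧ ∃ g : IwasawaAlgebra p, D.charIdeal = Ideal.span {g} ∧
      iwasawaToPowerSeries p g =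
        PowerSeries.C (ϖ : ℚ_[p]) * padicLFunction f (unitRoot W p : ℚ_[p]) :=
  h W p hp hgood hred κ γ hκ hγ hT f hf ϖ hϖ D

end Literature.NumberTheory.EllipticCurves.KellerYin2024

end
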